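import Summits.NavierStokesRegularity.NavierStokesRegularity.Theorems.TypeICertificateLadderNoTypeIBlowupLemma35
import Literature.Analysis.FluidPDE.ParasiticSlabFlow
import Literature.Analysis.FluidPDE.SereginSverakOffAxisTools
import Literature.Analysis.FluidPDE.SereginSverakBlowupLimit

/-!
# `TypeIConcentration` (stmt-NavierStokesRegularity-2881), line `bp-scaled-energy`: in the vertex
# stub the range of scales MUST depend on the unit-scale data (δ-regularised parasitic flow)

Negative (support) lemmas for the crux `TypeICertificateLadder.TypeIConcentration` (cdisprove seat,
generation 4; theorems only, no definitions) about the ONE registered stub of the lead's picked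
line `Cruxes/TypeIConcentration/Lines/bp-scaled-energy.lean`, `stub_scaledEnergyVertexEventually
(K) : ∃ d, ∀ M' ≠ ⊤, ∃ r₁ ∈ (0, 1/4], ∀ (v, q, G)` suitable weak in `Q(0,1)` with `v ∈ L³`, weak
gradient `G`, `√(-t)|v| ≤ K` a.e. and data `A(0,3/4;v) + E(0,3/4;G) + D(0,1;q) ≤ M'`,
`∀ r ∈ (0, r₁)`, `A + E + C + D ≤ d` (Seregin–Šverák 2009, Lemma 3.5 at the vertex, EVENTUAL
`K`-only form; the tree's `scaledEnergy_vertex_le_of_typeI` is the AFFINE form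
`≤ a(K)·data + d(K)` on `0 < r < 1/4`). The stub is true (iterate the landed contraction); shown
here: its quantifier shape is FORCED.

* The witness family is the Type-I parasitic flow of Koch–Nadirashvili–Seregin–Šverák 2009, §1
  (tree `parasiticVelocity K`, `parasiticPressure K`: `u = (K/√(-t)) e₀`, `p = -b′(t) x₁`) shifted
  by `δ²` in time, `u_{K,δ}(t, x) = parasiticVelocity K (t - δ²) x = (K/√(δ² - t)) e₀`: a suitable
  weak solution in `Q(0,1)` (`regParasitic_isSuitableWeakSolutionOn`), bounded by `K/δ` up to
  `t = 0` (the vertex is REGULAR; finite unit-scale data, `regParasitic_data_lt_top`), rate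
  `√(-t)|u| ≤ K` preserved (`regParasitic_rate`), weak gradient `0`, and
  `C(0, r; u) ≥ 3|B_r| K³/(8 r² δ)` (`le_cubicC_regParasitic`), unbounded as `δ ↓ 0` at every
  fixed scale (`exists_lt_cubicC_regParasitic`).
* `vertexStub_false_of_dataFreeRange` — the stub with `∃ r₁` moved before `∀ M'` (equivalently, the
  data hypothesis dropped) is FALSE at every level `K > 0`, already for the cubic term.
* `vertexStub_false_allScales` — the stub WITH its data hypothesis but on ALL scales `0 < r < 1/4`
  (a data-free Lemma 3.5: the affine `scaledEnergy_vertex_le_of_typeI` with `a(K) = 0`) is FALSE at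
  every level `K > 0`.

MORAL (lead / provers): the data `M'` can enter ONLY through the range `r₁`; any proof must let
`r₁ ↓ 0` as `M' ↑ ∞` (iteration count `≍ log M'`), and no fixed-scale estimate is `K`-only — which is
why item 2884 quantifies `∃ r₀` after the solution. [cite: KochNadirashviliSereginSverak2009, §1 p. 3]
[cite: SereginSverak2009, Lemma 3.5]
-/

noncomputable section

set_option linter.dupNamespace false

namespace Summit.NavierStokesRegularity.NavierStokesRegularity.Theorems.TypeIConcentration.Negative

open Set Filter Topology MeasureTheory Metric Function
open Literature.Analysis.FluidPDE Literature.Analysis.FluidPDE.SereginSverak2009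
open scoped NNReal ENNReal InnerProductSpace RealInnerProductSpace Laplacian

/-! ## The δ-regularised parasitic flow `u_{K,δ}(t, x) = parasiticVelocity K (t - δ²) x` -/

/-- `‖u_{K,δ}(t, x)‖ = K/√(δ² - t)` for `K ≥ 0`. [folklore] -/
theorem norm_regParasiticVel {K : ℝ} (hK : 0 ≤ K) (δ t : ℝ) (x : EuclideanSpace ℝ (Fin 3)) :
    ‖parasiticVelocity K (t - δ ^ 2) x‖ = K / Real.sqrt (δ ^ 2 - t) := by
  rw [norm_parasiticVelocity hK, neg_sub]

/-- The time shift `(t, x) ↦ (t - δ², x)` is smooth on `{t < δ²} × ℝ³` ... [folklore] -/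
theorem contDiffOn_timeShift (δ : ℝ) {n : WithTop ℕ∞} :
    ContDiffOn ℝ n (fun z : ℝ × EuclideanSpace ℝ (Fin 3) => (z.1 - δ ^ 2, z.2)) (Iio (δ ^ 2) ×ˢ univ) :=
  (contDiffOn_fst.sub contDiffOn_const).prodMk contDiffOn_snd

/-- ... and maps `{t < δ²} × ℝ³` into `{t < 0} × ℝ³`. [folklore] -/
theorem mapsTo_timeShift (δ : ℝ) :
    MapsTo (fun z : ℝ × EuclideanSpace ℝ (Fin 3) => (z.1 - δ ^ 2, z.2)) (Iio (δ ^ 2) ×ˢ univ)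
      (Iio 0 ×ˢ univ) := by
  intro z hz
  have h1 : z.1 < δ ^ 2 := hz.1
  exact ⟨show z.1 - δ ^ 2 < 0 by linarith, mem_univ _⟩

/-- The regularised velocity is jointly smooth on `t < δ²` (so up to and beyond `t = 0`). [folklore] -/
theorem contDiffOn_regParasiticVel (K δ : ℝ) {n : WithTop ℕ∞} :
    ContDiffOn ℝ n (uncurry fun t x => parasiticVelocity K (t - δ ^ 2) x) (Iio (δ ^ 2) ×ˢ univ) :=
  (contDiffOn_parasiticVelocity K).comp (contDiffOn_timeShift δ) (mapsTo_timeShift δ)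

/-- The regularised pressure is jointly `C¹` on `t < δ²`. [folklore] -/
theorem contDiffOn_regParasiticPres (K δ : ℝ) :
    ContDiffOn ℝ 1 (uncurry fun t x => parasiticPressure K (t - δ ^ 2) x) (Iio (δ ^ 2) ×ˢ univ) := by
  have h1 : ContDiffOn ℝ 1 (deriv (parasiticAmp K)) (Iio 0) :=
    (contDiffOn_parasiticAmp K (n := 1 + 1)).deriv_of_isOpen isOpen_Iio le_rfl
  have h1' : ContDiffOn ℝ 1 (fun z : ℝ × EuclideanSpace ℝ (Fin 3) => deriv (parasiticAmp K) (z.1 - δ ^ 2))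
      (Iio (δ ^ 2) ×ˢ univ) :=
    h1.comp (contDiffOn_fst.sub contDiffOn_const) fun z hz => (mapsTo_timeShift δ hz).1
  have h2 : ContDiffOn ℝ 1
      (fun z : ℝ × EuclideanSpace ℝ (Fin 3) => (-deriv (parasiticAmp K) (z.1 - δ ^ 2)) • parasiticDir)
      (Iio (δ ^ 2) ×ˢ univ) := (h1'.neg).smul contDiffOn_const
  exact h2.inner ℝ contDiffOn_snd

/-- `Q(0,1) ⊆ {t < 0} × ℝ³ ⊆ {t < δ²} × ℝ³`. [folklore] -/
theorem parCyl_one_subset_shiftRegion (δ : ℝ) :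
    parCyl (0 : ℝ × EuclideanSpace ℝ (Fin 3)) 1 ⊆ Iio (δ ^ 2) ×ˢ univ :=
  (parCyl_subset_Iio_prod 1).trans (prod_mono (Iio_subset_Iio (sq_nonneg δ)) Subset.rfl)

/-- The regularised pair solves Navier–Stokes (`ν = 1`, `f = 0`) pointwise on `t < δ²`
(time translate of `momentum_parasitic`). [cite: KochNadirashviliSereginSverak2009, §1] -/
theorem momentum_regParasitic (K δ : ℝ) {t : ℝ} (ht : t ∈ Iio (δ ^ 2)) (x : EuclideanSpace ℝ (Fin 3)) :
    timeDeriv (fun s y => parasiticVelocity K (s - δ ^ 2) y) t x +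
        convect (parasiticVelocity K (t - δ ^ 2)) (parasiticVelocity K (t - δ ^ 2)) x =
      (1 : ℝ) • (Δ (parasiticVelocity K (t - δ ^ 2))) x - gradient (parasiticPressure K (t - δ ^ 2)) x +
        (0 : ℝ → EuclideanSpace ℝ (Fin 3) → EuclideanSpace ℝ (Fin 3)) t x := by
  have ht' : t - δ ^ 2 ∈ Iio (0 : ℝ) := (mapsTo_timeShift δ (x := (t, x)) ⟨ht, mem_univ _⟩).1
  have htd : timeDeriv (fun s y => parasiticVelocity K (s - δ ^ 2) y) t x =
      timeDeriv (parasiticVelocity K) (t - δ ^ 2) x := by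
    simp only [timeDeriv_apply]
    exact deriv_comp_sub_const (f := fun s => parasiticVelocity K s x) (a := δ ^ 2) (x := t)
  rw [htd]
  exact momentum_parasitic K ht' x

/-- **The regularised parasitic pair is a suitable weak solution in the unit cylinder `Q(0,1)`**
(`C²/C¹` classical solutions are suitable, tree `isSuitableWeakSolutionOn_of_contDiffOn`). [cite: CaffarelliKohnNirenberg1982, §2] -/
theorem regParasitic_isSuitableWeakSolutionOn (K δ : ℝ) :
    IsSuitableWeakSolutionOn (parCylOpens 0 1) 1 0 (fun t x => parasiticVelocity K (t - δ ^ 2) x)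
      (fun t x => parasiticPressure K (t - δ ^ 2) x) :=
  isSuitableWeakSolutionOn_of_contDiffOn (S := Iio (δ ^ 2)) isOpen_Iio (parCyl_one_subset_shiftRegion δ)
    (contDiffOn_regParasiticVel K δ) (contDiffOn_regParasiticPres K δ) continuousOn_const
    (fun _ ht x => momentum_regParasitic K δ ht x) (fun t _ => isDivFree_parasiticVelocity K (t - δ ^ 2))

/-- The classical spatial gradient of the regularised flow vanishes (constant slices). [folklore] -/
theorem fderiv_regParasiticVel_eq_zero (K δ : ℝ) :
    (fun t x => fderiv ℝ (fun y => parasiticVelocity K (t - δ ^ 2) y) x) =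
      (0 : ℝ → EuclideanSpace ℝ (Fin 3) → EuclideanSpace ℝ (Fin 3) →L[ℝ] EuclideanSpace ℝ (Fin 3)) := by
  funext t x
  show fderiv ℝ (fun _ : EuclideanSpace ℝ (Fin 3) => parasiticAmp K (t - δ ^ 2) • parasiticDir) x = 0
  simp

/-- `G = 0` is a weak spatial gradient of the regularised flow in `Q(0,1)`. [folklore] -/
theorem regParasitic_hasWeakSpatialGradientOn (K δ : ℝ) :
    HasWeakSpatialGradientOn (parCylOpens 0 1) (fun t x => parasiticVelocity K (t - δ ^ 2) x) 0 := by
  rw [← fderiv_regParasiticVel_eq_zero K δ]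
  exact hasWeakSpatialGradientOn_of_contDiffOn (S := Iio (δ ^ 2)) isOpen_Iio
    (parCyl_one_subset_shiftRegion δ) (contDiffOn_regParasiticVel K δ)

/-- **The Type-I rate is preserved by the regularisation**: `√(-t) ‖u(t,x)‖ = K √(-t)/√(δ² - t) ≤ K`
for `t < 0`, `K ≥ 0`. [folklore] -/
theorem regParasitic_rate {K : ℝ} (hK : 0 ≤ K) (δ : ℝ) {t : ℝ} (ht : t < 0) (x : EuclideanSpace ℝ (Fin 3)) :
    Real.sqrt (-t) * ‖parasiticVelocity K (t - δ ^ 2) x‖ ≤ K := by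
  rw [norm_regParasiticVel hK]
  have hpos : 0 < Real.sqrt (δ ^ 2 - t) := Real.sqrt_pos.2 (by nlinarith [sq_nonneg δ])
  have hle : Real.sqrt (-t) ≤ Real.sqrt (δ ^ 2 - t) := Real.sqrt_le_sqrt (by nlinarith [sq_nonneg δ])
  calc Real.sqrt (-t) * (K / Real.sqrt (δ ^ 2 - t))
        = K * (Real.sqrt (-t) / Real.sqrt (δ ^ 2 - t)) := by ring
    _ ≤ K * 1 := mul_le_mul_of_nonneg_left ((div_le_one hpos).2 hle) hK
    _ = K := mul_one K

/-- The a.e. form of the rate on `Q(0,1)` (fourth hypothesis of the stub). [folklore] -/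
theorem regParasitic_rate_ae {K : ℝ} (hK : 0 ≤ K) (δ : ℝ) :
    ∀ᵐ z ∂(volume.restrict (parCyl (0 : ℝ × EuclideanSpace ℝ (Fin 3)) 1)),
      Real.sqrt (-z.1) * ‖parasiticVelocity K (z.1 - δ ^ 2) z.2‖ ≤ K := by
  refine (ae_restrict_iff' (isOpen_parCyl 0 1).measurableSet).2 (Eventually.of_forall fun z hz => ?_)
  rw [mem_parCyl_zero] at hz
  exact regParasitic_rate hK δ hz.1.2 z.2

/-- `‖u(t, x)‖ ≤ K/δ` for `t ≤ 0` (`δ > 0`, `K ≥ 0`): the regularised flow is BOUNDED up to the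
final time, so the vertex is a regular point. [folklore] -/
theorem norm_regParasiticVel_le {K δ : ℝ} (hK : 0 ≤ K) (hδ : 0 < δ) {t : ℝ} (ht : t ≤ 0)
    (x : EuclideanSpace ℝ (Fin 3)) : ‖parasiticVelocity K (t - δ ^ 2) x‖ ≤ K / δ := by
  rw [norm_regParasiticVel hK]
  have hle : δ ≤ Real.sqrt (δ ^ 2 - t) :=
    calc δ = Real.sqrt (δ ^ 2) := (Real.sqrt_sq hδ.le).symm
      _ ≤ Real.sqrt (δ ^ 2 - t) := Real.sqrt_le_sqrt (by linarith)
  exact div_le_div_of_nonneg_left hK hδ hle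

/-- `u ∈ L³(Q(0,1))` (bounded on a set of finite measure; second hypothesis of the stub). [folklore] -/
theorem regParasitic_L3 {K δ : ℝ} (hK : 0 ≤ K) (hδ : 0 < δ) :
    ∫⁻ z in parCyl (0 : ℝ × EuclideanSpace ℝ (Fin 3)) 1,
      ‖parasiticVelocity K (z.1 - δ ^ 2) z.2‖ₑ ^ (3 : ℕ) < ∞ := by
  have hle : ∀ z ∈ parCyl (0 : ℝ × EuclideanSpace ℝ (Fin 3)) 1,
      ‖parasiticVelocity K (z.1 - δ ^ 2) z.2‖ₑ ^ (3 : ℕ) ≤ ENNReal.ofReal (K / δ) ^ (3 : ℕ) := by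
    intro z hz
    rw [mem_parCyl_zero] at hz
    refine pow_le_pow_left' ?_ 3
    rw [← ofReal_norm]
    exact ENNReal.ofReal_le_ofReal (norm_regParasiticVel_le hK hδ hz.1.2.le z.2)
  calc ∫⁻ z in parCyl (0 : ℝ × EuclideanSpace ℝ (Fin 3)) 1, ‖parasiticVelocity K (z.1 - δ ^ 2) z.2‖ₑ ^ (3 : ℕ)
      ≤ ∫⁻ _ in parCyl (0 : ℝ × EuclideanSpace ℝ (Fin 3)) 1, ENNReal.ofReal (K / δ) ^ (3 : ℕ) :=
        setLIntegral_mono' (isOpen_parCyl 0 1).measurableSet hle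
    _ = ENNReal.ofReal (K / δ) ^ (3 : ℕ) * volume (parCyl (0 : ℝ × EuclideanSpace ℝ (Fin 3)) 1) :=
        setLIntegral_const _ _
    _ < ∞ := ENNReal.mul_lt_top (ENNReal.pow_lt_top ENNReal.ofReal_lt_top) (volume_parCyl_lt_top 1)

/-! ## The cubic functional of the regularised flow is unbounded as `δ ↓ 0` -/

/-- **Lower bound on `C(0, r; u)`**: for `3δ² ≤ r²` the sub-cylinder `]-3δ², 0[ × B_r` of `Q(0,r)`
carries `‖u‖ ≥ K/(2δ)`, so `C(0, r; u) ≥ r⁻² (K/(2δ))³ · 3δ² |B_r| = 3 |B_r| K³/(8 r² δ)`. [folklore] -/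
theorem le_cubicC_regParasitic {K δ r : ℝ} (hK : 0 ≤ K) (hδ : 0 < δ) (hr : 0 < r)
    (hδr : 3 * δ ^ 2 ≤ r ^ 2) :
    ENNReal.ofReal ((r ^ 2)⁻¹ * ((K / (2 * δ)) ^ 3 *
        (3 * δ ^ 2 * (volume (ball (0 : EuclideanSpace ℝ (Fin 3)) r)).toReal)))
      ≤ cubicC 0 r (fun t x => parasiticVelocity K (t - δ ^ 2) x) := by
  set S : Set (ℝ × EuclideanSpace ℝ (Fin 3)) :=
    Ioo (-(3 * δ ^ 2)) 0 ×ˢ ball (0 : EuclideanSpace ℝ (Fin 3)) r with hS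
  have hSsub : S ⊆ parCyl (0 : ℝ × EuclideanSpace ℝ (Fin 3)) r := by
    refine Subset.trans ?_ (parabolicCylinder_subset_parCyl r (0 : ℝ × EuclideanSpace ℝ (Fin 3)))
    rintro z ⟨⟨h1, h2⟩, h3⟩
    rw [mem_parabolicCylinder, Prod.fst_zero, Prod.snd_zero]
    exact ⟨⟨by linarith, h2⟩, mem_ball.1 h3⟩
  have hSmeas : MeasurableSet S := measurableSet_Ioo.prod measurableSet_ball
  have hV : volume (ball (0 : EuclideanSpace ℝ (Fin 3)) r) ≠ ⊤ := measure_ball_lt_top.ne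
  have hpt : ∀ z ∈ S, ENNReal.ofReal ((K / (2 * δ)) ^ 3) ≤
      ‖parasiticVelocity K (z.1 - δ ^ 2) z.2‖ₑ ^ (3 : ℕ) := by
    intro z hz
    obtain ⟨⟨h1, h2⟩, -⟩ := hz
    have hspos : 0 < Real.sqrt (δ ^ 2 - z.1) := Real.sqrt_pos.2 (by nlinarith)
    have hslt : Real.sqrt (δ ^ 2 - z.1) ≤ 2 * δ := by
      refine le_of_lt ((Real.sqrt_lt' (by positivity)).2 ?_)
      nlinarith
    have hle : K / (2 * δ) ≤ ‖parasiticVelocity K (z.1 - δ ^ 2) z.2‖ := by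
      rw [norm_regParasiticVel hK]
      exact div_le_div_of_nonneg_left hK hspos hslt
    calc ENNReal.ofReal ((K / (2 * δ)) ^ 3) = ENNReal.ofReal (K / (2 * δ)) ^ (3 : ℕ) :=
          ENNReal.ofReal_pow (by positivity) 3
      _ ≤ ENNReal.ofReal ‖parasiticVelocity K (z.1 - δ ^ 2) z.2‖ ^ (3 : ℕ) :=
          pow_le_pow_left' (ENNReal.ofReal_le_ofReal hle) 3
      _ = ‖parasiticVelocity K (z.1 - δ ^ 2) z.2‖ₑ ^ (3 : ℕ) := by rw [ofReal_norm]
  have hvolS : volume S = ENNReal.ofReal (3 * δ ^ 2) * volume (ball (0 : EuclideanSpace ℝ (Fin 3)) r) := by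
    rw [hS, Measure.volume_eq_prod, Measure.prod_prod, Real.volume_Ioo, sub_neg_eq_add, zero_add]
  have e1 : ENNReal.ofReal ((r ^ 2)⁻¹) = (ENNReal.ofReal r ^ 2)⁻¹ := by
    rw [ENNReal.ofReal_inv_of_pos (by positivity), ENNReal.ofReal_pow hr.le]
  have e2 : ENNReal.ofReal ((r ^ 2)⁻¹ * ((K / (2 * δ)) ^ 3 *
      (3 * δ ^ 2 * (volume (ball (0 : EuclideanSpace ℝ (Fin 3)) r)).toReal)))
      = (ENNReal.ofReal r ^ 2)⁻¹ * (ENNReal.ofReal ((K / (2 * δ)) ^ 3) * volume S) := by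
    rw [ENNReal.ofReal_mul (by positivity), e1, ENNReal.ofReal_mul (by positivity),
      ENNReal.ofReal_mul (by positivity), ENNReal.ofReal_toReal hV, hvolS]
  rw [e2]
  unfold cubicC
  refine mul_le_mul' le_rfl ?_
  calc ENNReal.ofReal ((K / (2 * δ)) ^ 3) * volume S
      = ∫⁻ _ in S, ENNReal.ofReal ((K / (2 * δ)) ^ 3) := (setLIntegral_const _ _).symm
    _ ≤ ∫⁻ z in S, ‖parasiticVelocity K (z.1 - δ ^ 2) z.2‖ₑ ^ (3 : ℕ) := setLIntegral_mono' hSmeas hpt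
    _ ≤ ∫⁻ z in parCyl (0 : ℝ × EuclideanSpace ℝ (Fin 3)) r,
        ‖parasiticVelocity K (z.1 - δ ^ 2) z.2‖ₑ ^ (3 : ℕ) := lintegral_mono_set hSsub

/-- **At every fixed scale `r > 0` the cubic functional of the admissible family is unbounded**
(`K > 0`): some `δ > 0` gives `C(0, r; u_{K,δ}) > d`. [folklore] -/
theorem exists_lt_cubicC_regParasitic {K : ℝ} (hK : 0 < K) (d : ℝ≥0) {r : ℝ} (hr : 0 < r) :
    ∃ δ : ℝ, 0 < δ ∧ (d : ℝ≥0∞) < cubicC 0 r (fun t x => parasiticVelocity K (t - δ ^ 2) x) := by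
  have hV0 : volume (ball (0 : EuclideanSpace ℝ (Fin 3)) r) ≠ 0 := (measure_ball_pos volume _ hr).ne'
  have hVtop : volume (ball (0 : EuclideanSpace ℝ (Fin 3)) r) ≠ ⊤ := measure_ball_lt_top.ne
  set V : ℝ := (volume (ball (0 : EuclideanSpace ℝ (Fin 3)) r)).toReal with hVdef
  have hVpos : 0 < V := ENNReal.toReal_pos hV0 hVtop
  set c₀ : ℝ := 3 * K ^ 3 * V / (8 * r ^ 2) with hc₀
  have hc₀pos : 0 < c₀ := by positivity
  set δ : ℝ := min (r / 2) (c₀ / ((d : ℝ) + 1)) with hδdef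
  have hδpos : 0 < δ := lt_min (by positivity) (by positivity)
  have hδr : δ ≤ r / 2 := min_le_left _ _
  have hδc : δ ≤ c₀ / ((d : ℝ) + 1) := min_le_right _ _
  refine ⟨δ, hδpos, ?_⟩
  have h3 : 3 * δ ^ 2 ≤ r ^ 2 := by nlinarith
  refine lt_of_lt_of_le ?_ (le_cubicC_regParasitic hK.le hδpos hr h3)
  have hX : (r ^ 2)⁻¹ * ((K / (2 * δ)) ^ 3 * (3 * δ ^ 2 * V)) = c₀ / δ := by
    rw [hc₀]
    field_simp
    ring
  rw [hX, ← ENNReal.ofReal_coe_nnreal, ENNReal.ofReal_lt_ofReal_iff (by positivity), lt_div_iff₀ hδpos]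
  have h1 : δ * ((d : ℝ) + 1) ≤ c₀ := by rwa [← le_div_iff₀ (by positivity)]
  nlinarith [hδpos]

/-! ## The quantifier shape of the vertex stub is forced -/

/-- **The range of scales must depend on the data (level by level).** For every `K > 0` it is
FALSE that some `K`-only level `d` bounds the scaled energies of every Type-I(`K`) suitable weak
solution in `Q(0,1)` on some `K`-only range of scales `(0, r₁)`: the stub
`stub_scaledEnergyVertexEventually` with `∃ r₁` moved in front of `∀ M'` (equivalently, with its
data hypothesis `A(0,3/4) + E(0,3/4) + D(0,1) ≤ M'` dropped) fails — the regularised parasitic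
flows satisfy every remaining hypothesis and have `C(0, r₁/2) → ∞` as `δ ↓ 0`.
[cite: KochNadirashviliSereginSverak2009, §1 p. 3] -/
theorem vertexStub_false_of_dataFreeRange {K : ℝ} (hK : 0 < K) :
    ¬ ∃ d : ℝ≥0, ∃ r₁ : ℝ, 0 < r₁ ∧ r₁ ≤ 1 / 4 ∧
      ∀ (v : ℝ → EuclideanSpace ℝ (Fin 3) → EuclideanSpace ℝ (Fin 3))
        (q : ℝ → EuclideanSpace ℝ (Fin 3) → ℝ)
        (G : ℝ → EuclideanSpace ℝ (Fin 3) → EuclideanSpace ℝ (Fin 3) →L[ℝ] EuclideanSpace ℝ (Fin 3)),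
        IsSuitableWeakSolutionOn (parCylOpens 0 1) 1 0 v q →
        (∫⁻ z in parCyl 0 1, ‖v z.1 z.2‖ₑ ^ (3 : ℕ) < ∞) →
        HasWeakSpatialGradientOn (parCylOpens 0 1) v G →
        (∀ᵐ z ∂(volume.restrict (parCyl 0 1)), Real.sqrt (-z.1) * ‖v z.1 z.2‖ ≤ K) →
        ∀ r ∈ Ioo (0 : ℝ) r₁,
          energyA 0 r v + dissipationE 0 r G + cubicC 0 r v + pressureD 0 r q ≤ d := by
  rintro ⟨d, r₁, hr₁, -, h⟩
  obtain ⟨δ, hδ, hlt⟩ := exists_lt_cubicC_regParasitic hK d (half_pos hr₁)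
  have hle := h _ _ 0 (regParasitic_isSuitableWeakSolutionOn K δ) (regParasitic_L3 hK.le hδ)
    (regParasitic_hasWeakSpatialGradientOn K δ) (regParasitic_rate_ae hK.le δ)
    (r₁ / 2) ⟨half_pos hr₁, half_lt_self hr₁⟩
  exact absurd (hlt.trans_le (le_trans (le_add_self.trans le_self_add) hle)) (lt_irrefl _)

/-! ## The admissible family has finite unit-scale data -/

/-- `E(0, r; 0) = 0`: the dissipation functional of the zero gradient. [folklore] -/
theorem dissipationE_zero (r : ℝ) :
    dissipationE 0 r (0 : ℝ → EuclideanSpace ℝ (Fin 3) → EuclideanSpace ℝ (Fin 3) →L[ℝ]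
      EuclideanSpace ℝ (Fin 3)) = 0 := by
  unfold dissipationE
  simp [frobeniusNormSq_zero]

/-- `A(0, 3/4; u) < ∞` for the regularised flow (`‖u‖ ≤ K/δ` up to `t = 0`). [folklore] -/
theorem energyA_regParasitic_lt_top {K δ : ℝ} (hK : 0 ≤ K) (hδ : 0 < δ) :
    energyA 0 (3 / 4) (fun t x => parasiticVelocity K (t - δ ^ 2) x) < ∞ := by
  unfold energyA
  have hvol : volume (spaceCyl (0 : EuclideanSpace ℝ (Fin 3)) (3 / 4)) < ∞ :=
    (measure_mono (spaceCyl_subset_ball (0 : EuclideanSpace ℝ (Fin 3))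
      (by norm_num : (0 : ℝ) ≤ 3 / 4))).trans_lt measure_ball_lt_top
  set B : ℝ≥0∞ := (ENNReal.ofReal (3 / 4 : ℝ))⁻¹ *
    (ENNReal.ofReal (K / δ) ^ 2 * volume (spaceCyl (0 : EuclideanSpace ℝ (Fin 3)) (3 / 4))) with hB
  have hBtop : B < ∞ := by
    refine ENNReal.mul_lt_top (ENNReal.inv_lt_top.2 (by simp)) ?_
    exact ENNReal.mul_lt_top (ENNReal.pow_lt_top ENNReal.ofReal_lt_top) hvol
  refine lt_of_le_of_lt (essSup_le_of_ae_le B ?_) hBtop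
  refine (ae_restrict_iff' measurableSet_Ioo).2 (Eventually.of_forall fun t ht => ?_)
  simp only [Prod.fst_zero, Prod.snd_zero] at ht ⊢
  refine mul_le_mul' le_rfl ?_
  have hle : ∀ x ∈ spaceCyl (0 : EuclideanSpace ℝ (Fin 3)) (3 / 4),
      ‖parasiticVelocity K (t - δ ^ 2) x‖ₑ ^ 2 ≤ ENNReal.ofReal (K / δ) ^ 2 := by
    intro x _
    refine pow_le_pow_left' ?_ 2
    rw [← ofReal_norm]
    exact ENNReal.ofReal_le_ofReal (norm_regParasiticVel_le hK hδ ht.2.le x)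
  calc ∫⁻ x in spaceCyl (0 : EuclideanSpace ℝ (Fin 3)) (3 / 4), ‖parasiticVelocity K (t - δ ^ 2) x‖ₑ ^ 2
      ≤ ∫⁻ _ in spaceCyl (0 : EuclideanSpace ℝ (Fin 3)) (3 / 4), ENNReal.ofReal (K / δ) ^ 2 :=
        setLIntegral_mono' (isOpen_spaceCyl 0 _).measurableSet hle
    _ = ENNReal.ofReal (K / δ) ^ 2 * volume (spaceCyl (0 : EuclideanSpace ℝ (Fin 3)) (3 / 4)) :=
        setLIntegral_const _ _

/-- `D(0, 1; p) < ∞` for the regularised flow: `p` is continuous on the compact set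
`[-1, 0] × B̄₂ ⊇ Q(0,1)` inside its smoothness region, hence bounded there. [folklore] -/
theorem pressureD_regParasitic_lt_top (K : ℝ) {δ : ℝ} (hδ : 0 < δ) :
    pressureD 0 1 (fun t x => parasiticPressure K (t - δ ^ 2) x) < ∞ := by
  unfold pressureD
  set C : Set (ℝ × EuclideanSpace ℝ (Fin 3)) :=
    Icc (-1 : ℝ) 0 ×ˢ closedBall (0 : EuclideanSpace ℝ (Fin 3)) 2 with hC
  have hCcpt : IsCompact C := isCompact_Icc.prod (isCompact_closedBall _ _)
  have hCsub : C ⊆ Iio (δ ^ 2) ×ˢ univ := fun z hz => ⟨lt_of_le_of_lt hz.1.2 (by positivity), mem_univ _⟩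
  have hQC : parCyl (0 : ℝ × EuclideanSpace ℝ (Fin 3)) 1 ⊆ C := by
    intro z hz
    rw [mem_parCyl_zero] at hz
    refine ⟨⟨by nlinarith [hz.1.1], hz.1.2.le⟩, mem_closedBall_zero_iff.2 ?_⟩
    exact (norm_le_cylRadius_add_abs z.2).trans (by linarith [hz.2.1, hz.2.2])
  have hcont : ContinuousOn (uncurry fun t x => parasiticPressure K (t - δ ^ 2) x) C :=
    (contDiffOn_regParasiticPres K δ).continuousOn.mono hCsub
  obtain ⟨M, hM⟩ := hCcpt.exists_bound_of_continuousOn hcont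
  have hle : ∀ z ∈ parCyl (0 : ℝ × EuclideanSpace ℝ (Fin 3)) 1,
      ‖parasiticPressure K (z.1 - δ ^ 2) z.2‖ₑ ^ (3 / 2 : ℝ) ≤ ENNReal.ofReal M ^ (3 / 2 : ℝ) := by
    intro z hz
    refine ENNReal.rpow_le_rpow ?_ (by norm_num)
    rw [← ofReal_norm]
    exact ENNReal.ofReal_le_ofReal (hM z (hQC hz))
  refine ENNReal.mul_lt_top (ENNReal.inv_lt_top.2 (by simp)) ?_
  calc ∫⁻ z in parCyl (0 : ℝ × EuclideanSpace ℝ (Fin 3)) 1, ‖parasiticPressure K (z.1 - δ ^ 2) z.2‖ₑ ^ (3 / 2 : ℝ)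
      ≤ ∫⁻ _ in parCyl (0 : ℝ × EuclideanSpace ℝ (Fin 3)) 1, ENNReal.ofReal M ^ (3 / 2 : ℝ) :=
        setLIntegral_mono' (isOpen_parCyl 0 1).measurableSet hle
    _ = ENNReal.ofReal M ^ (3 / 2 : ℝ) * volume (parCyl (0 : ℝ × EuclideanSpace ℝ (Fin 3)) 1) :=
        setLIntegral_const _ _
    _ < ∞ := ENNReal.mul_lt_top
        (ENNReal.rpow_lt_top_of_nonneg (by norm_num) ENNReal.ofReal_ne_top) (volume_parCyl_lt_top 1)

/-- **The regularised flows have finite unit-scale data** `A(0,3/4) + E(0,3/4) + D(0,1) < ∞` (the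
fifth hypothesis of the stub is met with `M'` = this value). [folklore] -/
theorem regParasitic_data_lt_top {K δ : ℝ} (hK : 0 ≤ K) (hδ : 0 < δ) :
    energyA 0 (3 / 4) (fun t x => parasiticVelocity K (t - δ ^ 2) x) + dissipationE 0 (3 / 4)
        (0 : ℝ → EuclideanSpace ℝ (Fin 3) → EuclideanSpace ℝ (Fin 3) →L[ℝ] EuclideanSpace ℝ (Fin 3)) +
      pressureD 0 1 (fun t x => parasiticPressure K (t - δ ^ 2) x) < ∞ := by
  rw [dissipationE_zero, add_zero]
  exact ENNReal.add_lt_top.2 ⟨energyA_regParasitic_lt_top hK hδ, pressureD_regParasitic_lt_top K hδ⟩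

/-- **No `K`-only bound at all scales (level by level).** For every `K > 0` it is FALSE that a
`K`-only level `d` bounds `A + E + C + D` on ALL scales `0 < r < 1/4` for every Type-I(`K`)
suitable weak solution in `Q(0,1)` with FINITE unit-scale data: the stub WITH its data hypothesis
but without the data-dependent range `r₁(K, M')` — i.e. the affine Lemma 3.5
`scaledEnergy_vertex_le_of_typeI` with its data coefficient `a(K)` set to zero — fails on the
regularised parasitic flows (`C(0, 1/8) → ∞` as `δ ↓ 0`, data finite for each `δ`). So the
eventual reshaping of the stub (data enter only through the range of scales) is NECESSARY, not
cosmetic. [cite: SereginSverak2009, Lemma 3.5] -/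
theorem vertexStub_false_allScales {K : ℝ} (hK : 0 < K) :
    ¬ ∃ d : ℝ≥0, ∀ M' : ℝ≥0∞, M' ≠ ⊤ →
      ∀ (v : ℝ → EuclideanSpace ℝ (Fin 3) → EuclideanSpace ℝ (Fin 3))
        (q : ℝ → EuclideanSpace ℝ (Fin 3) → ℝ)
        (G : ℝ → EuclideanSpace ℝ (Fin 3) → EuclideanSpace ℝ (Fin 3) →L[ℝ] EuclideanSpace ℝ (Fin 3)),
        IsSuitableWeakSolutionOn (parCylOpens 0 1) 1 0 v q →
        (∫⁻ z in parCyl 0 1, ‖v z.1 z.2‖ₑ ^ (3 : ℕ) < ∞) →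
        HasWeakSpatialGradientOn (parCylOpens 0 1) v G →
        (∀ᵐ z ∂(volume.restrict (parCyl 0 1)), Real.sqrt (-z.1) * ‖v z.1 z.2‖ ≤ K) →
        energyA 0 (3 / 4) v + dissipationE 0 (3 / 4) G + pressureD 0 1 q ≤ M' →
        ∀ r ∈ Ioo (0 : ℝ) (1 / 4),
          energyA 0 r v + dissipationE 0 r G + cubicC 0 r v + pressureD 0 r q ≤ d := by
  rintro ⟨d, h⟩
  obtain ⟨δ, hδ, hlt⟩ := exists_lt_cubicC_regParasitic hK d (by norm_num : (0 : ℝ) < 1 / 8)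
  have hdata := regParasitic_data_lt_top hK.le hδ
  have hle := h _ hdata.ne _ _ 0 (regParasitic_isSuitableWeakSolutionOn K δ) (regParasitic_L3 hK.le hδ)
    (regParasitic_hasWeakSpatialGradientOn K δ) (regParasitic_rate_ae hK.le δ) le_rfl
    (1 / 8) ⟨by norm_num, by norm_num⟩
  exact absurd (hlt.trans_le (le_trans (le_add_self.trans le_self_add) hle)) (lt_irrefl _)

end Summit.NavierStokesRegularity.NavierStokesRegularity.Theorems.TypeIConcentration.Negative

end
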